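import Summits.Ventures.PercRepro.KernelLaw3
import Summits.Ventures.PercRepro.C012MED

/-!
# The determinant inequality (MED) is false: a kernel-checked refutation

`PercRepro.MED` (C012MED.lean) asserts `(xz − y₁y₂)² ≤ y₃(x + z)(x + y₁)(y₂ + z)` on the rows of
every marked triple. It fails — by a relative margin of `1.3·10⁻⁴` — on a 6-vertex, 7-edge graph
in which `a` and `c` are almost identified and `b` is a pendant vertex of tiny weight: vertices
`0, 1, 2, 3, 4, 5` with marks `a = 4`, `b = 5`, `c = 1`, edges
`0: 0–1 (3/4)`, `1: 0–3 (3/4)`, `2: 0–4 (1/4)`, `3: 1–2 (3/4)`, `4: 1–4 (999/1000)`, `5: 2–3 (1/4)`,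
`6: 2–5 (10⁻⁸)`. Over the `128` configurations the five cells are
`(x, y₁, y₂, y₃, z) = (806355, 3, 102317699193645, 642, 82299999355) / 102400000000000`
(`law3NatTuple_medWit`, one kernel pass), and then
`(xz − y₁y₂)² − y₃(x+z)(x+y₁)(y₂+z) = 586740182405748531192650528100 / 102400000000000⁴ > 0`:
`not_MED`. (The witness is the pendant-`t` degeneration of the `(COV)` witness of
`proofs/P5-MED.md` §7; the `(MED)` slack there is `t²·(Cov² − P(bc|a)P(ab)P(a≁c)) + O(t³)`.)
-/

namespace PercRepro

namespace Examples

open MultiGraph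

/-- The witness graph: marks `a = 4`, `b = 5`, `c = 1`; edges
`0: 0–1, 1: 0–3, 2: 0–4, 3: 1–2, 4: 1–4, 5: 2–3, 6: 2–5`. -/
def medWit : MultiGraph (Fin 6) (Fin 7) := ⟨![0, 0, 0, 1, 1, 2, 2], ![1, 3, 4, 2, 4, 3, 5]⟩

/-- Numerators of the witness weights `3/4, 3/4, 1/4, 3/4, 999/1000, 1/4, 1/100000000`. -/
def medNum : Fin 7 → ℕ := ![3, 3, 1, 3, 999, 1, 1]

/-- Denominators of the witness weights. -/
def medDen : Fin 7 → ℕ := ![4, 4, 4, 4, 1000, 4, 100000000]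

/-- The witness weights as real edge probabilities. -/
noncomputable def medP : Fin 7 → ℝ := fun e => (medNum e : ℝ) / medDen e

/-- The witness weights lie in `[0, 1]`. -/
theorem isProb_medP : IsProb medP := by
  intro e
  fin_cases e <;> norm_num [medP, medNum, medDen]

/-- The five cells of the witness in one kernel pass over the `128` configurations. -/
theorem law3NatTuple_medWit :
    medWit.law3NatTuple 4 5 1 medNum medDen = (806355, 3, 102317699193645, 642, 82299999355) := by
  decide +kernel

/-- The five cells of the witness, as real row probabilities. -/
theorem law3_medWit :
    medWit.law3 medP 4 5 1 0 = 806355 / 102400000000000 ∧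
    medWit.law3 medP 4 5 1 1 = 3 / 102400000000000 ∧
    medWit.law3 medP 4 5 1 2 = 102317699193645 / 102400000000000 ∧
    medWit.law3 medP 4 5 1 3 = 642 / 102400000000000 ∧
    medWit.law3 medP 4 5 1 4 = 82299999355 / 102400000000000 := by
  have hab : ∀ e, medNum e ≤ medDen e := fun e => by
    fin_cases e <;> norm_num [medNum, medDen]
  have hb : ∀ e, 0 < medDen e := fun e => by
    fin_cases e <;> norm_num [medDen]
  have hprod : (∏ e, (medDen e : ℝ)) = 102400000000000 := by
    simp [Fin.prod_univ_succ, medDen]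
    norm_num
  have h := medWit.law3_of_law3NatTuple medNum medDen hab hb 4 5 1 law3NatTuple_medWit
  rw [hprod] at h
  exact h

/-- **(MED) is false**: on the witness the determinant exceeds the bound. -/
theorem not_MED : ¬ MED := by
  intro h
  have hc := h medWit medP isProb_medP 4 5 1
  obtain ⟨e0, e1, e2, e3, e4⟩ := law3_medWit
  rw [e0, e1, e2, e3, e4] at hc
  norm_num at hc

end Examples

end PercRepro
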